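import Literature.IUT.HodgeTheaters.TemperedCoveringsCor23iiOfSpecialFibre
import Literature.IUT.HodgeTheaters.TemperedCoveringsCor23OfSpecialFibreAllLevels
import HarnessLib

/-!
# [IUTchI] Corollary 2.3 (i)–(iv) at the GENUINE 𝔛-datum: the REDUCED binder list
# `{h22, hH, hOutTp, hA′, hB′}` — `hker` discharged in abc-iut-L5-d5's all-level form

Mochizuki, *Inter-universal Teichmüller theory I: construction of Hodge theaters*, kurims manuscript
(May 2020), §2, Corollary 2.3 (i)–(iv) pp. 47–49 [cite: Mochizuki2012, Cor 2.3 pp.47-49] (D-0012 claim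
key; series status DISPUTED; nothing of the series is asserted here).

PROOF-ONLY capstone (no definition, no new named fact; node `IUTchI:Cor2.3(iii)`, board holder
abc-iut-w4-d058) composing the two binder reductions of the Cor. 2.3 (i)–(iv) assembly at
`StableCurveTemperedData.ofSpecialFibre` that landed independently this hour:

* abc-iut-L5-d5's `cor23_i_to_iv_ofSpecialFibre_reduced` (`TemperedCoveringsCor23OfSpecialFibreAllLevels`):
  the cofinal tower `J`/`hcof` replaced by the ALL-LEVEL form `hA′`/`hB′` of the `ℍ`-free (KER-LEVEL)
  conclusions, and the profinite descent atom `hOutHat` derived from `hOutTp` + (ii)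
  (`outerHat_of_outerTp`);
* abc-iut-w4-d058's `ofSpecialFibre_ker_ρHat_subset_closure` (`TemperedCoveringsCor23iiOfSpecialFibre`):
  the density atom `hker` is a THEOREM at the genuine datum (right exactness of profinite completion for
  the open admissible quotient).

Result `cor23_i_to_iv_ofSpecialFibre_reduced'`: Cor. 2.3 (i)–(iv) AS TYPED at the genuine datum from
EXACTLY `h22` (Prop. 2.2 for the special-fibre 𝔾-data), `hH` (`Π̂_ℍ =` closure of `Π^tp_ℍ` — a constraint
on the bare parameters, definitional for `Π̂_ℍ :=` that closure), `hOutTp` ("`ℍ` is `G_k`-stable",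
p. 47 l. 25–26, for the bare parameter `Π^tp_ℍ`) and `hA′`/`hB′` (the printed per-level slimness
conclusions under (a)/(b), each reducible to the printed inputs by `mem_level_of_comm_ker_of_inputs`).
This is the binder list the layer-5 certificate's §2 row can cite (`layer5_held_sec2`, v0.2).
Model-RELATIVE as the bridge; typed ≠ discharged; nothing here bears on [IUTchIII] Cor. 3.12.
-/

noncomputable section

namespace Literature.IUT.HodgeTheaters

open _root_.Topology
open scoped Pointwise
open Literature.AnabelianGeometry.SemiGraphs

namespace StableCurveTemperedData

variable {p : ℕ} [Fact p.Prime] (X : TemperedCurve p) (d : X.GroupLevelData)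
  (S : SpecialFibreData (X.toTemperedArithmeticGroup d)) (h36 : S.Gc.Prop36Hypotheses)
  (Sigma SigmaHat : Set ℕ) (hsub : Sigma ⊆ SigmaHat) (hne : Sigma.Nonempty)
  (hprime : ∀ q ∈ SigmaHat, q.Prime) (hp : p ∉ Sigma)
  (TpH : Subgroup S.chart.G)
  (HatH : Subgroup (TemperedGraphGroupData.exists_completion_of_prop36 S.Gc h36 S.chart).choose)
  (hle : TpH.map (TemperedGraphGroupData.exists_completion_of_prop36 S.Gc h36
    S.chart).choose_spec.choose.toMonoidHom ≤ HatH)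
  (cuspMeetsH : {x : X.Pt // X.IsCusp x} → Prop)

/-- **[IUTchI] Cor. 2.3 (i)–(iv) AS TYPED at the genuine 𝔛-datum from the REDUCED binder list
`{h22, hH, hOutTp, hA′, hB′}`**: abc-iut-L5-d5's `cor23_i_to_iv_ofSpecialFibre_reduced` with its density
binder `hker` DISCHARGED by `ofSpecialFibre_ker_ρHat_subset_closure`.  Remaining inputs, all BY NAME:
Prop. 2.2 for the special-fibre 𝔾-data (`h22`); `Π̂_ℍ =` closure of `Π^tp_ℍ` (`hH`); the tempered
descent atom (`hOutTp`); the all-level `ℍ`-free slimness conclusions under (a) (`hA′`) / (b) (`hB′`).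
([IUTchI] Cor 2.3 pp.47-49) [claim: Mochizuki2012, status: disputed] -/
theorem cor23_i_to_iv_ofSpecialFibre_reduced'
    (h22 : (ofSpecialFibre X d S h36 Sigma SigmaHat hsub hne hprime hp TpH HatH hle
            cuspMeetsH).graph.CommensuratorsOfDecompositionSubgroups)
    (hH : ((ofSpecialFibre X d S h36 Sigma SigmaHat hsub hne hprime hp TpH HatH hle cuspMeetsH).graph.HatH :
        Set (ofSpecialFibre X d S h36 Sigma SigmaHat hsub hne hprime hp TpH HatH hle cuspMeetsH).graph.Hat) =
      closure ((ofSpecialFibre X d S h36 Sigma SigmaHat hsub hne hprime hp TpH HatH hle cuspMeetsH).graph.ι ''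
        (ofSpecialFibre X d S h36 Sigma SigmaHat hsub hne hprime hp TpH HatH hle cuspMeetsH).graph.TpH))
    (hOutTp : ∀ g : (ofSpecialFibre X d S h36 Sigma SigmaHat hsub hne hprime hp TpH HatH hle cuspMeetsH).PiTp,
      ∃ δ : (ofSpecialFibre X d S h36 Sigma SigmaHat hsub hne hprime hp TpH HatH hle cuspMeetsH).DeltaTp,
        MulAut.conj g • ((ofSpecialFibre X d S h36 Sigma SigmaHat hsub hne hprime hp TpH HatH hle
            cuspMeetsH).deltaTpH.map
          (ofSpecialFibre X d S h36 Sigma SigmaHat hsub hne hprime hp TpH HatH hle cuspMeetsH).DeltaTp.subtype) =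
        MulAut.conj (δ : (ofSpecialFibre X d S h36 Sigma SigmaHat hsub hne hprime hp TpH HatH hle
            cuspMeetsH).PiTp) •
          ((ofSpecialFibre X d S h36 Sigma SigmaHat hsub hne hprime hp TpH HatH hle cuspMeetsH).deltaTpH.map
            (ofSpecialFibre X d S h36 Sigma SigmaHat hsub hne hprime hp TpH HatH hle cuspMeetsH).DeltaTp.subtype))
    (hA' : (∃ l ∈ SigmaHat, l ∉ Sigma ∧ l ≠ p) →
      ∀ W : Subgroup (ofSpecialFibre X d S h36 Sigma SigmaHat hsub hne hprime hp TpH HatH hle cuspMeetsH).DeltaHat,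
        W.Normal → IsOpen (W : Set (ofSpecialFibre X d S h36 Sigma SigmaHat hsub hne hprime hp TpH HatH hle
            cuspMeetsH).DeltaHat) →
        ∀ a : (ofSpecialFibre X d S h36 Sigma SigmaHat hsub hne hprime hp TpH HatH hle cuspMeetsH).DeltaHat,
          (∀ x ∈ W, x ∈ (ofSpecialFibre X d S h36 Sigma SigmaHat hsub hne hprime hp TpH HatH hle
            cuspMeetsH).ρHat.ker → a * x = x * a) → a ∈ W)
    (hB' : SigmaHat = {q | q.Prime} →
      ∀ W : Subgroup (ofSpecialFibre X d S h36 Sigma SigmaHat hsub hne hprime hp TpH HatH hle cuspMeetsH).DeltaHat,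
        W.Normal → IsOpen (W : Set (ofSpecialFibre X d S h36 Sigma SigmaHat hsub hne hprime hp TpH HatH hle
            cuspMeetsH).DeltaHat) →
        ∀ a : (ofSpecialFibre X d S h36 Sigma SigmaHat hsub hne hprime hp TpH HatH hle cuspMeetsH).DeltaHat,
          (∀ x ∈ W, x ∈ (ofSpecialFibre X d S h36 Sigma SigmaHat hsub hne hprime hp TpH HatH hle
            cuspMeetsH).ρHat.ker → a * x = x * a) → a ∈ W) :
    (ofSpecialFibre X d S h36 Sigma SigmaHat hsub hne hprime hp TpH HatH hle cuspMeetsH).Cor23i ∧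
      (ofSpecialFibre X d S h36 Sigma SigmaHat hsub hne hprime hp TpH HatH hle cuspMeetsH).Cor23ii ∧
      (ofSpecialFibre X d S h36 Sigma SigmaHat hsub hne hprime hp TpH HatH hle cuspMeetsH).Cor23iii ∧
      (ofSpecialFibre X d S h36 Sigma SigmaHat hsub hne hprime hp TpH HatH hle cuspMeetsH).Cor23iv :=
  cor23_i_to_iv_ofSpecialFibre_reduced X d S h36 Sigma SigmaHat hsub hne hprime hp TpH HatH hle cuspMeetsH
    h22 hH
    (ofSpecialFibre_ker_ρHat_subset_closure X d S h36 Sigma SigmaHat hsub hne hprime hp TpH HatH hle cuspMeetsH)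
    hOutTp hA' hB'


/-! ### v2 (append-only): the same with `Π̂_ℍ :=` the closure of `Π^tp_ℍ` — `hH` definitional

For the parameter choice `Π̂_ℍ :=` the closure of `ι(Π^tp_ℍ)` in `Π̂_𝔾` (print's `Π̂_ℋ`, p. 44 l. 39–44: the
pro-`Σ̂` fundamental group of `ℋ` regarded inside `Π̂_𝒢`, compact with `Π^tp_ℋ` dense, hence that closure)
the binder `hH` holds by `rfl` up to `Subgroup.topologicalClosure_coe`, and the two data atoms `Π̂_ℍ`,
`Π^tp_ℍ ↪ Π̂_ℍ` of the bridge are no longer free: Cor. 2.3 (i)–(iv) AS TYPED from `{h22, hOutTp, hA′, hB′}`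
for EVERY `Π^tp_ℍ ≤ π₁^temp(G^c)`.  Offered to the layer-5 certificate as an alternative §2 datum (the
choice between the general-parameter row and this one is the L5-lead's). -/

section

variable {p : ℕ} [Fact p.Prime] (X : TemperedCurve p) (d : X.GroupLevelData)
  (S : SpecialFibreData (X.toTemperedArithmeticGroup d)) (h36 : S.Gc.Prop36Hypotheses)
  (Sigma SigmaHat : Set ℕ) (hsub : Sigma ⊆ SigmaHat) (hne : Sigma.Nonempty)
  (hprime : ∀ q ∈ SigmaHat, q.Prime) (hp : p ∉ Sigma)
  (TpH : Subgroup S.chart.G)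
  (cuspMeetsH : {x : X.Pt // X.IsCusp x} → Prop)

/-- **[IUTchI] Cor. 2.3 (i)–(iv) AS TYPED at the genuine 𝔛-datum with `Π̂_ℍ :=` the closure of `Π^tp_ℍ`,
from `{h22, hOutTp, hA′, hB′}`** — `cor23_i_to_iv_ofSpecialFibre_reduced'` at that parameter choice, the
density binder `hH` being definitional there. ([IUTchI] Cor 2.3 pp.47-49) [claim: Mochizuki2012, status: disputed] -/
theorem cor23_i_to_iv_ofSpecialFibre_reduced_closureH
    (h22 : (ofSpecialFibre X d S h36 Sigma SigmaHat hsub hne hprime hp TpH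
      ((TpH.map (TemperedGraphGroupData.exists_completion_of_prop36 S.Gc h36
        S.chart).choose_spec.choose.toMonoidHom).topologicalClosure) (Subgroup.le_topologicalClosure _) cuspMeetsH).graph.CommensuratorsOfDecompositionSubgroups)
    (hOutTp : ∀ g : (ofSpecialFibre X d S h36 Sigma SigmaHat hsub hne hprime hp TpH
      ((TpH.map (TemperedGraphGroupData.exists_completion_of_prop36 S.Gc h36
        S.chart).choose_spec.choose.toMonoidHom).topologicalClosure) (Subgroup.le_topologicalClosure _) cuspMeetsH).PiTp,
      ∃ δ : (ofSpecialFibre X d S h36 Sigma SigmaHat hsub hne hprime hp TpH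
      ((TpH.map (TemperedGraphGroupData.exists_completion_of_prop36 S.Gc h36
        S.chart).choose_spec.choose.toMonoidHom).topologicalClosure) (Subgroup.le_topologicalClosure _) cuspMeetsH).DeltaTp,
        MulAut.conj g • ((ofSpecialFibre X d S h36 Sigma SigmaHat hsub hne hprime hp TpH
      ((TpH.map (TemperedGraphGroupData.exists_completion_of_prop36 S.Gc h36
        S.chart).choose_spec.choose.toMonoidHom).topologicalClosure) (Subgroup.le_topologicalClosure _) cuspMeetsH).deltaTpH.map
          (ofSpecialFibre X d S h36 Sigma SigmaHat hsub hne hprime hp TpH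
      ((TpH.map (TemperedGraphGroupData.exists_completion_of_prop36 S.Gc h36
        S.chart).choose_spec.choose.toMonoidHom).topologicalClosure) (Subgroup.le_topologicalClosure _) cuspMeetsH).DeltaTp.subtype) =
        MulAut.conj (δ : (ofSpecialFibre X d S h36 Sigma SigmaHat hsub hne hprime hp TpH
      ((TpH.map (TemperedGraphGroupData.exists_completion_of_prop36 S.Gc h36
        S.chart).choose_spec.choose.toMonoidHom).topologicalClosure) (Subgroup.le_topologicalClosure _) cuspMeetsH).PiTp) •
          ((ofSpecialFibre X d S h36 Sigma SigmaHat hsub hne hprime hp TpH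
      ((TpH.map (TemperedGraphGroupData.exists_completion_of_prop36 S.Gc h36
        S.chart).choose_spec.choose.toMonoidHom).topologicalClosure) (Subgroup.le_topologicalClosure _) cuspMeetsH).deltaTpH.map
            (ofSpecialFibre X d S h36 Sigma SigmaHat hsub hne hprime hp TpH
      ((TpH.map (TemperedGraphGroupData.exists_completion_of_prop36 S.Gc h36
        S.chart).choose_spec.choose.toMonoidHom).topologicalClosure) (Subgroup.le_topologicalClosure _) cuspMeetsH).DeltaTp.subtype))
    (hA' : (∃ l ∈ SigmaHat, l ∉ Sigma ∧ l ≠ p) →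
      ∀ W : Subgroup (ofSpecialFibre X d S h36 Sigma SigmaHat hsub hne hprime hp TpH
      ((TpH.map (TemperedGraphGroupData.exists_completion_of_prop36 S.Gc h36
        S.chart).choose_spec.choose.toMonoidHom).topologicalClosure) (Subgroup.le_topologicalClosure _) cuspMeetsH).DeltaHat,
        W.Normal → IsOpen (W : Set (ofSpecialFibre X d S h36 Sigma SigmaHat hsub hne hprime hp TpH
      ((TpH.map (TemperedGraphGroupData.exists_completion_of_prop36 S.Gc h36
        S.chart).choose_spec.choose.toMonoidHom).topologicalClosure) (Subgroup.le_topologicalClosure _) cuspMeetsH).DeltaHat) →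
        ∀ a : (ofSpecialFibre X d S h36 Sigma SigmaHat hsub hne hprime hp TpH
      ((TpH.map (TemperedGraphGroupData.exists_completion_of_prop36 S.Gc h36
        S.chart).choose_spec.choose.toMonoidHom).topologicalClosure) (Subgroup.le_topologicalClosure _) cuspMeetsH).DeltaHat,
          (∀ x ∈ W, x ∈ (ofSpecialFibre X d S h36 Sigma SigmaHat hsub hne hprime hp TpH
      ((TpH.map (TemperedGraphGroupData.exists_completion_of_prop36 S.Gc h36
        S.chart).choose_spec.choose.toMonoidHom).topologicalClosure) (Subgroup.le_topologicalClosure _) cuspMeetsH).ρHat.ker → a * x = x * a) → a ∈ W)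
    (hB' : SigmaHat = {q | q.Prime} →
      ∀ W : Subgroup (ofSpecialFibre X d S h36 Sigma SigmaHat hsub hne hprime hp TpH
      ((TpH.map (TemperedGraphGroupData.exists_completion_of_prop36 S.Gc h36
        S.chart).choose_spec.choose.toMonoidHom).topologicalClosure) (Subgroup.le_topologicalClosure _) cuspMeetsH).DeltaHat,
        W.Normal → IsOpen (W : Set (ofSpecialFibre X d S h36 Sigma SigmaHat hsub hne hprime hp TpH
      ((TpH.map (TemperedGraphGroupData.exists_completion_of_prop36 S.Gc h36
        S.chart).choose_spec.choose.toMonoidHom).topologicalClosure) (Subgroup.le_topologicalClosure _) cuspMeetsH).DeltaHat) →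
        ∀ a : (ofSpecialFibre X d S h36 Sigma SigmaHat hsub hne hprime hp TpH
      ((TpH.map (TemperedGraphGroupData.exists_completion_of_prop36 S.Gc h36
        S.chart).choose_spec.choose.toMonoidHom).topologicalClosure) (Subgroup.le_topologicalClosure _) cuspMeetsH).DeltaHat,
          (∀ x ∈ W, x ∈ (ofSpecialFibre X d S h36 Sigma SigmaHat hsub hne hprime hp TpH
      ((TpH.map (TemperedGraphGroupData.exists_completion_of_prop36 S.Gc h36
        S.chart).choose_spec.choose.toMonoidHom).topologicalClosure) (Subgroup.le_topologicalClosure _) cuspMeetsH).ρHat.ker → a * x = x * a) → a ∈ W) :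
    (ofSpecialFibre X d S h36 Sigma SigmaHat hsub hne hprime hp TpH
      ((TpH.map (TemperedGraphGroupData.exists_completion_of_prop36 S.Gc h36
        S.chart).choose_spec.choose.toMonoidHom).topologicalClosure) (Subgroup.le_topologicalClosure _) cuspMeetsH).Cor23i ∧
      (ofSpecialFibre X d S h36 Sigma SigmaHat hsub hne hprime hp TpH
      ((TpH.map (TemperedGraphGroupData.exists_completion_of_prop36 S.Gc h36
        S.chart).choose_spec.choose.toMonoidHom).topologicalClosure) (Subgroup.le_topologicalClosure _) cuspMeetsH).Cor23ii ∧
      (ofSpecialFibre X d S h36 Sigma SigmaHat hsub hne hprime hp TpH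
      ((TpH.map (TemperedGraphGroupData.exists_completion_of_prop36 S.Gc h36
        S.chart).choose_spec.choose.toMonoidHom).topologicalClosure) (Subgroup.le_topologicalClosure _) cuspMeetsH).Cor23iii ∧
      (ofSpecialFibre X d S h36 Sigma SigmaHat hsub hne hprime hp TpH
      ((TpH.map (TemperedGraphGroupData.exists_completion_of_prop36 S.Gc h36
        S.chart).choose_spec.choose.toMonoidHom).topologicalClosure) (Subgroup.le_topologicalClosure _) cuspMeetsH).Cor23iv :=
  cor23_i_to_iv_ofSpecialFibre_reduced' X d S h36 Sigma SigmaHat hsub hne hprime hp TpH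
    ((TpH.map (TemperedGraphGroupData.exists_completion_of_prop36 S.Gc h36
      S.chart).choose_spec.choose.toMonoidHom).topologicalClosure) (Subgroup.le_topologicalClosure _)
    cuspMeetsH h22 (by
      show (((TpH.map (TemperedGraphGroupData.exists_completion_of_prop36 S.Gc h36
            S.chart).choose_spec.choose.toMonoidHom).topologicalClosure :
          Subgroup (TemperedGraphGroupData.exists_completion_of_prop36 S.Gc h36 S.chart).choose) :
            Set (TemperedGraphGroupData.exists_completion_of_prop36 S.Gc h36 S.chart).choose) =
        closure ((TemperedGraphGroupData.exists_completion_of_prop36 S.Gc h36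
            S.chart).choose_spec.choose.toMonoidHom '' (TpH : Set S.chart.G))
      rw [Subgroup.topologicalClosure_coe, Subgroup.coe_map])
    hOutTp hA' hB'

end


/-! ### v3 (append-only): the tempered descent atom `hOutTp` from print's "`ℍ` is `G_k`-stable"

[IUTchI] p. 47 l. 25–26: "the sub-semi-graph `ℍ ⊆ 𝔾` is stabilized by the natural action of `G_k` on `𝔾`".
The natural action of `Π^tp_X` (through `G_k = Π^tp_X/Δ^tp_X`) on `π₁^temp(G^c)` EXISTS in the L3 tree:
abc-iut-L3-t2's `SpecialFibreData.autOfConj hK0 g : π₁^temp(G^c) ≃ₜ* π₁^temp(G^c)`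
(`TemperedSpecialFibreDataVertexAction.lean`, [SemiAnbd] Ex. 3.10 p. 44), the automorphism induced by
conjugation by `g ∈ Π^tp_X` under the binder (P0)₀ `hK0` "the admissible kernel is normal in `Π^tp_X`"
(G-w4d063-1).  Hence the group-theoretic binder `hOutTp` of the reduced list is IMPLIED by (P0)₀ and the
printed hypothesis in its group form `hHstab : ∀ g, ∃ t, autOfConj g (Π^tp_ℍ) = t Π^tp_ℍ t⁻¹` ("the
decomposition group of `ℍ` — well-defined up to `Π^tp_𝔾`-conjugacy, p. 44 l. 43 — is carried to itself by
the `G_k`-action"), through abc-iut-w4-d058's `outerTp_of_graphStable` (`TemperedCoveringsCor23iiiProofs`).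
Final binder lists at the genuine datum: `{h22, hH, hK0, hHstab, hA′, hB′}`, and `{h22, hK0, hHstab, hA′, hB′}`
for `Π̂_ℍ :=` the closure of `Π^tp_ℍ`. -/

section

variable {p : ℕ} [Fact p.Prime] (X : TemperedCurve p) (d : X.GroupLevelData)
  (S : SpecialFibreData (X.toTemperedArithmeticGroup d)) (h36 : S.Gc.Prop36Hypotheses)
  (Sigma SigmaHat : Set ℕ) (hsub : Sigma ⊆ SigmaHat) (hne : Sigma.Nonempty)
  (hprime : ∀ q ∈ SigmaHat, q.Prime) (hp : p ∉ Sigma)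
  (TpH : Subgroup S.chart.G)
  (HatH : Subgroup (TemperedGraphGroupData.exists_completion_of_prop36 S.Gc h36 S.chart).choose)
  (hle : TpH.map (TemperedGraphGroupData.exists_completion_of_prop36 S.Gc h36
    S.chart).choose_spec.choose.toMonoidHom ≤ HatH)
  (cuspMeetsH : {x : X.Pt // X.IsCusp x} → Prop)

/-- **The tempered descent atom `hOutTp` at the genuine datum from "`ℍ` is `G_k`-stable"** (p. 47
l. 25–26): under (P0)₀ `hK0` (the admissible kernel is normal in `Π^tp_X`, so that conjugation by
`g ∈ Π^tp_X` induces `autOfConj hK0 g` on `π₁^temp(G^c)`), if each `autOfConj hK0 g` carries `Π^tp_ℍ` to a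
`π₁^temp(G^c)`-conjugate of itself, then every `g Δ^tp_{X,ℍ} g⁻¹` is a `Δ^tp_X`-conjugate of `Δ^tp_{X,ℍ}`.
([IUTchI] Cor 2.3(i) p.47) [claim: Mochizuki2012, status: disputed] -/
theorem ofSpecialFibre_outerTp_of_graphStable
    (hK0 : (S.admissible.toMonoidHom.ker.map (X.toTemperedArithmeticGroup d).delta.subtype).Normal)
    (hHstab : ∀ g : X.PiTemp, ∃ t : S.chart.G,
      TpH.map (S.autOfConj hK0 g).toMulEquiv.toMonoidHom = MulAut.conj t • TpH) :
    ∀ g : (ofSpecialFibre X d S h36 Sigma SigmaHat hsub hne hprime hp TpH HatH hle cuspMeetsH).PiTp,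
      ∃ δ : (ofSpecialFibre X d S h36 Sigma SigmaHat hsub hne hprime hp TpH HatH hle cuspMeetsH).DeltaTp,
        MulAut.conj g • ((ofSpecialFibre X d S h36 Sigma SigmaHat hsub hne hprime hp TpH HatH hle
            cuspMeetsH).deltaTpH.map
          (ofSpecialFibre X d S h36 Sigma SigmaHat hsub hne hprime hp TpH HatH hle cuspMeetsH).DeltaTp.subtype) =
        MulAut.conj (δ : (ofSpecialFibre X d S h36 Sigma SigmaHat hsub hne hprime hp TpH HatH hle
            cuspMeetsH).PiTp) •
          ((ofSpecialFibre X d S h36 Sigma SigmaHat hsub hne hprime hp TpH HatH hle cuspMeetsH).deltaTpH.map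
            (ofSpecialFibre X d S h36 Sigma SigmaHat hsub hne hprime hp TpH HatH hle cuspMeetsH).DeltaTp.subtype) := by
  intro g
  obtain ⟨t, ht⟩ := hHstab g
  refine (ofSpecialFibre X d S h36 Sigma SigmaHat hsub hne hprime hp TpH HatH hle cuspMeetsH).outerTp_of_graphStable g
    (S.autOfConj hK0 g).toMulEquiv t (fun x => ?_) ht
  have hx : ((x : (ofSpecialFibre X d S h36 Sigma SigmaHat hsub hne hprime hp TpH HatH hle cuspMeetsH).DeltaTp) : X.PiTemp) ∈
      (X.toTemperedArithmeticGroup d).delta := by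
    rw [← OfSpecialFibre.ker_augGK_eq_delta X d]; exact x.2
  exact (S.autOfConj_admissible hK0 g ⟨(x : X.PiTemp), hx⟩).symm

/-- **[IUTchI] Cor. 2.3 (i)–(iv) AS TYPED at the genuine 𝔛-datum from `{h22, hH, hK0, hHstab, hA′, hB′}`**:
`cor23_i_to_iv_ofSpecialFibre_reduced'` with the tempered descent atom supplied by
`ofSpecialFibre_outerTp_of_graphStable` — i.e. from Prop. 2.2 for the special-fibre 𝔾-data, `Π̂_ℍ =`
closure of `Π^tp_ℍ`, (P0)₀, "`ℍ` is `G_k`-stable" (group form), and the all-level `ℍ`-free slimness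
conclusions under (a)/(b). ([IUTchI] Cor 2.3 pp.47-49) [claim: Mochizuki2012, status: disputed] -/
theorem cor23_i_to_iv_ofSpecialFibre_of_graphStable
    (h22 : (ofSpecialFibre X d S h36 Sigma SigmaHat hsub hne hprime hp TpH HatH hle
            cuspMeetsH).graph.CommensuratorsOfDecompositionSubgroups)
    (hH : ((ofSpecialFibre X d S h36 Sigma SigmaHat hsub hne hprime hp TpH HatH hle cuspMeetsH).graph.HatH :
        Set (ofSpecialFibre X d S h36 Sigma SigmaHat hsub hne hprime hp TpH HatH hle cuspMeetsH).graph.Hat) =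
      closure ((ofSpecialFibre X d S h36 Sigma SigmaHat hsub hne hprime hp TpH HatH hle cuspMeetsH).graph.ι ''
        (ofSpecialFibre X d S h36 Sigma SigmaHat hsub hne hprime hp TpH HatH hle cuspMeetsH).graph.TpH))
    (hK0 : (S.admissible.toMonoidHom.ker.map (X.toTemperedArithmeticGroup d).delta.subtype).Normal)
    (hHstab : ∀ g : X.PiTemp, ∃ t : S.chart.G,
      TpH.map (S.autOfConj hK0 g).toMulEquiv.toMonoidHom = MulAut.conj t • TpH)
    (hA' : (∃ l ∈ SigmaHat, l ∉ Sigma ∧ l ≠ p) →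
      ∀ W : Subgroup (ofSpecialFibre X d S h36 Sigma SigmaHat hsub hne hprime hp TpH HatH hle cuspMeetsH).DeltaHat,
        W.Normal → IsOpen (W : Set (ofSpecialFibre X d S h36 Sigma SigmaHat hsub hne hprime hp TpH HatH hle
            cuspMeetsH).DeltaHat) →
        ∀ a : (ofSpecialFibre X d S h36 Sigma SigmaHat hsub hne hprime hp TpH HatH hle cuspMeetsH).DeltaHat,
          (∀ x ∈ W, x ∈ (ofSpecialFibre X d S h36 Sigma SigmaHat hsub hne hprime hp TpH HatH hle
            cuspMeetsH).ρHat.ker → a * x = x * a) → a ∈ W)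
    (hB' : SigmaHat = {q | q.Prime} →
      ∀ W : Subgroup (ofSpecialFibre X d S h36 Sigma SigmaHat hsub hne hprime hp TpH HatH hle cuspMeetsH).DeltaHat,
        W.Normal → IsOpen (W : Set (ofSpecialFibre X d S h36 Sigma SigmaHat hsub hne hprime hp TpH HatH hle
            cuspMeetsH).DeltaHat) →
        ∀ a : (ofSpecialFibre X d S h36 Sigma SigmaHat hsub hne hprime hp TpH HatH hle cuspMeetsH).DeltaHat,
          (∀ x ∈ W, x ∈ (ofSpecialFibre X d S h36 Sigma SigmaHat hsub hne hprime hp TpH HatH hle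
            cuspMeetsH).ρHat.ker → a * x = x * a) → a ∈ W) :
    (ofSpecialFibre X d S h36 Sigma SigmaHat hsub hne hprime hp TpH HatH hle cuspMeetsH).Cor23i ∧
      (ofSpecialFibre X d S h36 Sigma SigmaHat hsub hne hprime hp TpH HatH hle cuspMeetsH).Cor23ii ∧
      (ofSpecialFibre X d S h36 Sigma SigmaHat hsub hne hprime hp TpH HatH hle cuspMeetsH).Cor23iii ∧
      (ofSpecialFibre X d S h36 Sigma SigmaHat hsub hne hprime hp TpH HatH hle cuspMeetsH).Cor23iv :=
  cor23_i_to_iv_ofSpecialFibre_reduced' X d S h36 Sigma SigmaHat hsub hne hprime hp TpH HatH hle cuspMeetsH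
    h22 hH
    (ofSpecialFibre_outerTp_of_graphStable X d S h36 Sigma SigmaHat hsub hne hprime hp TpH HatH hle cuspMeetsH
      hK0 hHstab)
    hA' hB'

end

section

variable {p : ℕ} [Fact p.Prime] (X : TemperedCurve p) (d : X.GroupLevelData)
  (S : SpecialFibreData (X.toTemperedArithmeticGroup d)) (h36 : S.Gc.Prop36Hypotheses)
  (Sigma SigmaHat : Set ℕ) (hsub : Sigma ⊆ SigmaHat) (hne : Sigma.Nonempty)
  (hprime : ∀ q ∈ SigmaHat, q.Prime) (hp : p ∉ Sigma)
  (TpH : Subgroup S.chart.G)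
  (cuspMeetsH : {x : X.Pt // X.IsCusp x} → Prop)

/-- **[IUTchI] Cor. 2.3 (i)–(iv) AS TYPED at the genuine 𝔛-datum with `Π̂_ℍ :=` the closure of `Π^tp_ℍ`,
from `{h22, hK0, hHstab, hA′, hB′}`** — the closure-`ℍ` row with the tempered descent atom supplied by
`ofSpecialFibre_outerTp_of_graphStable`. ([IUTchI] Cor 2.3 pp.47-49) [claim: Mochizuki2012, status: disputed] -/
theorem cor23_i_to_iv_ofSpecialFibre_closureH_of_graphStable
    (h22 : (ofSpecialFibre X d S h36 Sigma SigmaHat hsub hne hprime hp TpH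
      ((TpH.map (TemperedGraphGroupData.exists_completion_of_prop36 S.Gc h36
        S.chart).choose_spec.choose.toMonoidHom).topologicalClosure) (Subgroup.le_topologicalClosure _) cuspMeetsH).graph.CommensuratorsOfDecompositionSubgroups)
    (hK0 : (S.admissible.toMonoidHom.ker.map (X.toTemperedArithmeticGroup d).delta.subtype).Normal)
    (hHstab : ∀ g : X.PiTemp, ∃ t : S.chart.G,
      TpH.map (S.autOfConj hK0 g).toMulEquiv.toMonoidHom = MulAut.conj t • TpH)
    (hA' : (∃ l ∈ SigmaHat, l ∉ Sigma ∧ l ≠ p) →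
      ∀ W : Subgroup (ofSpecialFibre X d S h36 Sigma SigmaHat hsub hne hprime hp TpH
      ((TpH.map (TemperedGraphGroupData.exists_completion_of_prop36 S.Gc h36
        S.chart).choose_spec.choose.toMonoidHom).topologicalClosure) (Subgroup.le_topologicalClosure _) cuspMeetsH).DeltaHat,
        W.Normal → IsOpen (W : Set (ofSpecialFibre X d S h36 Sigma SigmaHat hsub hne hprime hp TpH
      ((TpH.map (TemperedGraphGroupData.exists_completion_of_prop36 S.Gc h36
        S.chart).choose_spec.choose.toMonoidHom).topologicalClosure) (Subgroup.le_topologicalClosure _) cuspMeetsH).DeltaHat) →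
        ∀ a : (ofSpecialFibre X d S h36 Sigma SigmaHat hsub hne hprime hp TpH
      ((TpH.map (TemperedGraphGroupData.exists_completion_of_prop36 S.Gc h36
        S.chart).choose_spec.choose.toMonoidHom).topologicalClosure) (Subgroup.le_topologicalClosure _) cuspMeetsH).DeltaHat,
          (∀ x ∈ W, x ∈ (ofSpecialFibre X d S h36 Sigma SigmaHat hsub hne hprime hp TpH
      ((TpH.map (TemperedGraphGroupData.exists_completion_of_prop36 S.Gc h36
        S.chart).choose_spec.choose.toMonoidHom).topologicalClosure) (Subgroup.le_topologicalClosure _) cuspMeetsH).ρHat.ker → a * x = x * a) → a ∈ W)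
    (hB' : SigmaHat = {q | q.Prime} →
      ∀ W : Subgroup (ofSpecialFibre X d S h36 Sigma SigmaHat hsub hne hprime hp TpH
      ((TpH.map (TemperedGraphGroupData.exists_completion_of_prop36 S.Gc h36
        S.chart).choose_spec.choose.toMonoidHom).topologicalClosure) (Subgroup.le_topologicalClosure _) cuspMeetsH).DeltaHat,
        W.Normal → IsOpen (W : Set (ofSpecialFibre X d S h36 Sigma SigmaHat hsub hne hprime hp TpH
      ((TpH.map (TemperedGraphGroupData.exists_completion_of_prop36 S.Gc h36
        S.chart).choose_spec.choose.toMonoidHom).topologicalClosure) (Subgroup.le_topologicalClosure _) cuspMeetsH).DeltaHat) →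
        ∀ a : (ofSpecialFibre X d S h36 Sigma SigmaHat hsub hne hprime hp TpH
      ((TpH.map (TemperedGraphGroupData.exists_completion_of_prop36 S.Gc h36
        S.chart).choose_spec.choose.toMonoidHom).topologicalClosure) (Subgroup.le_topologicalClosure _) cuspMeetsH).DeltaHat,
          (∀ x ∈ W, x ∈ (ofSpecialFibre X d S h36 Sigma SigmaHat hsub hne hprime hp TpH
      ((TpH.map (TemperedGraphGroupData.exists_completion_of_prop36 S.Gc h36
        S.chart).choose_spec.choose.toMonoidHom).topologicalClosure) (Subgroup.le_topologicalClosure _) cuspMeetsH).ρHat.ker → a * x = x * a) → a ∈ W) :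
    (ofSpecialFibre X d S h36 Sigma SigmaHat hsub hne hprime hp TpH
      ((TpH.map (TemperedGraphGroupData.exists_completion_of_prop36 S.Gc h36
        S.chart).choose_spec.choose.toMonoidHom).topologicalClosure) (Subgroup.le_topologicalClosure _) cuspMeetsH).Cor23i ∧
      (ofSpecialFibre X d S h36 Sigma SigmaHat hsub hne hprime hp TpH
      ((TpH.map (TemperedGraphGroupData.exists_completion_of_prop36 S.Gc h36
        S.chart).choose_spec.choose.toMonoidHom).topologicalClosure) (Subgroup.le_topologicalClosure _) cuspMeetsH).Cor23ii ∧
      (ofSpecialFibre X d S h36 Sigma SigmaHat hsub hne hprime hp TpH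
      ((TpH.map (TemperedGraphGroupData.exists_completion_of_prop36 S.Gc h36
        S.chart).choose_spec.choose.toMonoidHom).topologicalClosure) (Subgroup.le_topologicalClosure _) cuspMeetsH).Cor23iii ∧
      (ofSpecialFibre X d S h36 Sigma SigmaHat hsub hne hprime hp TpH
      ((TpH.map (TemperedGraphGroupData.exists_completion_of_prop36 S.Gc h36
        S.chart).choose_spec.choose.toMonoidHom).topologicalClosure) (Subgroup.le_topologicalClosure _) cuspMeetsH).Cor23iv :=
  cor23_i_to_iv_ofSpecialFibre_reduced_closureH X d S h36 Sigma SigmaHat hsub hne hprime hp TpH cuspMeetsH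
    h22
    (ofSpecialFibre_outerTp_of_graphStable X d S h36 Sigma SigmaHat hsub hne hprime hp TpH
      ((TpH.map (TemperedGraphGroupData.exists_completion_of_prop36 S.Gc h36
        S.chart).choose_spec.choose.toMonoidHom).topologicalClosure) (Subgroup.le_topologicalClosure _)
      cuspMeetsH hK0 hHstab)
    hA' hB'

end

end StableCurveTemperedData

end Literature.IUT.HodgeTheaters

end
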